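import Summits.KontsevichZagierPeriods.KontsevichZagierPeriods.Theorems.RootDecompQuadraticDescentPair18HomotopyAngP09

/-! # `RootDecompQuadraticDescentPair18HomotopyAngP10` — part 10/20 of the mechanical ≤400-line split of `Pair18HomotopyAng_v13_landing.lean` (sha256 01bf0af4c8d09f43…)
Source: decomp-kz lens-6 g9 `Pair18HomotopyAng.lean` v13 (HOME/decomp-kz-lens-6/g9/, sha256 bd7fcda1…; critic g5 19:35:56Z CLEARED «angle side of #18 PROVED»: hTh7_holds, hB17_holds, hAng4_holds with no hypotheses) — companion file #2 of Pair18Homotopy v14 (landed as …Pair18HomotopyP01–P31): the verbatim COPIED PRELUDE is dropped in favour of those landed declarations, the four homonyms with different bodies are renamed (Th7_eq', TriA, isSemialgebraic_TriA, volume_diag'), `#print axioms` pins removed.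
Split by census-1 g9 `gen/splitlean.py`: scopes re-opened with their `open`/`variable`/`set_option` context; mathematics and declaration order unchanged. -/

set_option linter.unusedSimpArgs false
noncomputable section
open _root_.Set MvPolynomial
namespace Summit.KontsevichZagierPeriods.RootDecompQuadraticDescent.Pair18Homotopy
open Literature.NumberTheory.Transcendental
open Literature.NumberTheory.Transcendental.KZ (RFun cube)
open Summit.KontsevichZagierPeriods.RootDecompQuadraticDescent.DarkPairs (rel_reflect_rep rel_double)
section Fold
open Literature.ModelTheory.ExponentialFields (IsSemialgebraic isSemialgebraic_setOf_eval_le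
  isSemialgebraic_setOf_eval_pos isSemialgebraic_setOf_eval_nonneg isSemialgebraic_setOf_eval_eq_zero)

open _root_.Set MvPolynomial in
open Literature.NumberTheory.Transcendental in
open Literature.NumberTheory.Transcendental.KZ (RFun cube) in
open Summit.KontsevichZagierPeriods.RootDecompQuadraticDescent.DarkPairs (rel_reflect_rep rel_double) in
/-- Auxiliary step `vec2_1` (§2b): vec2 1. [bookkeeping] -/
private theorem vec2_1 (a b : ℝ) : (![a, b] : Fin 2 → ℝ) 1 = b := rfl

open _root_.Set MvPolynomial in
open Literature.NumberTheory.Transcendental in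
open Literature.NumberTheory.Transcendental.KZ (RFun cube) in
open Summit.KontsevichZagierPeriods.RootDecompQuadraticDescent.DarkPairs (rel_reflect_rep rel_double) in
/-- Auxiliary step `vec2_0` (§2b): vec2 0. [bookkeeping] -/
private theorem vec2_0 (a b : ℝ) : (![a, b] : Fin 2 → ℝ) 0 = a := rfl

open _root_.Set MvPolynomial in
open Literature.NumberTheory.Transcendental in
open Literature.NumberTheory.Transcendental.KZ (RFun cube) in
open Summit.KontsevichZagierPeriods.RootDecompQuadraticDescent.DarkPairs (rel_reflect_rep rel_double) in
/-- Auxiliary step `cube2` (§0): cube2. [bookkeeping] -/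
private theorem cube2 {x : Fin 2 → ℝ} (hx : x ∈ KZ.cube 2) : (0 ≤ x 0 ∧ x 0 ≤ 1) ∧ (0 ≤ x 1 ∧ x 1 ≤ 1) := ⟨hx 0, hx 1⟩

set_option maxHeartbeats 800000 in
/-- **`[AngH | RM⁻] ≡ [AngH | Fan]`** by the reflection `(s,w) ↦ (s, 1−w)` (`Q ↦ −Q`, `|det| = 1`). -/
theorem AngHMneg_reflect : KZ.of AngHMneg - KZ.of AngHFan ∈ KZ.relations := by
  let Φ : (Fin 2 → ℝ) → (Fin 2 → ℝ) := fun z => ![z 0, 1 - z 1]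
  let Mz : Matrix (Fin 2) (Fin 2) ℝ := !![1, 0; 0, -1]
  let Φ' : (Fin 2 → ℝ) → (Fin 2 → ℝ) →L[ℝ] (Fin 2 → ℝ) := fun _ =>
    LinearMap.toContinuousLinearMap (Matrix.toLin' Mz)
  have hΦ'ap : ∀ z w, Φ' z w = ![w 0, -w 1] := by
    intro z w; funext i
    fin_cases i <;> simp [Φ', Mz, Matrix.toLin'_apply, Matrix.mulVec, dotProduct, Fin.sum_univ_two]
  have hdet : ∀ z, (Φ' z).det = -1 := by
    intro z
    unfold ContinuousLinearMap.det
    simp [Φ', LinearMap.det_toLin', Mz, Matrix.det_fin_two]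
  have hΦ0 : ∀ z, Φ z 0 = z 0 := fun z => rfl
  have hΦ1 : ∀ z, Φ z 1 = 1 - z 1 := fun z => rfl
  have hdom : AngHFan.domain = Φ '' AngHMneg.domain := by
    simp only [AngHFan, AngHMneg, KZ.IntegralRep.domain_restrict, RFun.rep_domain]
    ext w
    constructor
    · intro hw
      obtain ⟨hc, ⟨⟨⟨r1, r2⟩, u1⟩, u2⟩⟩ := hw
      have hw0 := (cube2 hc).1
      have hw1 := (cube2 hc).2
      simp only [sRM1, sRM2, sU1, sU2, mem_setOf_eq] at r1 r2 u1 u2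
      have hQ0 : (0:ℝ) ≤ 4 * w 1 - 2 := by linarith
      refine ⟨![w 0, 1 - w 1], ⟨⟨?_, ⟨⟨⟨?_, ?_⟩, ?_⟩, ?_⟩⟩, ?_⟩, ?_⟩
      · intro i
        fin_cases i
        · simp only [Fin.zero_eta, Matrix.cons_val_zero]; exact hw0
        · simp only [Fin.mk_one, Matrix.cons_val_one, Matrix.head_cons, Matrix.cons_val_fin_one]
          constructor <;> linarith [hw1.1, hw1.2]
      · simp only [sRM1, mem_setOf_eq, Matrix.cons_val_zero]; exact r1
      · simp only [sRM2, mem_setOf_eq, Matrix.cons_val_zero]; exact r2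
      · simp only [sRM3, mem_setOf_eq, Matrix.cons_val_zero, Matrix.cons_val_one, Matrix.head_cons,
          Matrix.cons_val_fin_one]
        linarith
      · simp only [sRM4, mem_setOf_eq, Matrix.cons_val_zero, Matrix.cons_val_one, Matrix.head_cons,
          Matrix.cons_val_fin_one]
        nlinarith [mul_le_mul u2 u2 hQ0 (by linarith), mul_self_nonneg (w 0)]
      · show 4 * (![w 0, 1 - w 1] 1) ≤ 2
        simp only [Matrix.cons_val_one, Matrix.head_cons, Matrix.cons_val_fin_one]; linarith
      · funext i
        fin_cases i
        · simp only [Φ, Fin.zero_eta, Matrix.cons_val_zero]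
        · simp only [Φ, Fin.mk_one, Matrix.cons_val_one, Matrix.head_cons, Matrix.cons_val_fin_one]; ring
    · rintro ⟨z, hz, rfl⟩
      obtain ⟨⟨hc, ⟨⟨⟨r1, r2⟩, r3⟩, r4⟩⟩, qn⟩ := hz
      have h0 := (cube2 hc).1
      have h1 := (cube2 hc).2
      simp only [sRM1, sRM2, sRM3, sRM4, sQn, mem_setOf_eq] at r1 r2 r3 r4 qn
      refine ⟨fun i => ?_, ⟨⟨⟨?_, ?_⟩, ?_⟩, ?_⟩⟩
      · fin_cases i
        · simp only [Φ, Fin.zero_eta, Matrix.cons_val_zero]; exact h0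
        · simp only [Φ, Fin.mk_one, Matrix.cons_val_one, Matrix.head_cons, Matrix.cons_val_fin_one]
          constructor <;> linarith [h1.1, h1.2]
      · simp only [sRM1, mem_setOf_eq, Φ, Matrix.cons_val_zero]; exact r1
      · simp only [sRM2, mem_setOf_eq, Φ, Matrix.cons_val_zero]; exact r2
      · simp only [sU1, mem_setOf_eq, Φ, Matrix.cons_val_one, Matrix.head_cons, Matrix.cons_val_fin_one]
        linarith
      · simp only [sU2, mem_setOf_eq, Φ, Matrix.cons_val_zero, Matrix.cons_val_one, Matrix.head_cons,
          Matrix.cons_val_fin_one]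
        linarith
  refine KZ.changeOfVariablesRel_subset_relations ⟨2, AngHMneg, AngHFan, Φ, Φ', ?_, ?_, ?_, hdom, ?_, rfl⟩
  · have hsd : IsSemialgebraic ℚ AngHMneg.domain := AngHMneg.isSemialgebraic_domain
    refine (isSemialgebraicMapOn_iff_forall_holds hsd).mpr fun i => ?_
    fin_cases i
    · exact (isSemialgebraicFunOn_aeval hsd (X 0)).congr fun z _ => by
        simp only [Φ, Fin.zero_eta, Matrix.cons_val_zero, aeval_X]
    · exact (isSemialgebraicFunOn_aeval hsd (C 1 - X 1)).congr fun z _ => by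
        simp only [Φ, Fin.mk_one, Matrix.cons_val_one, Matrix.head_cons, Matrix.cons_val_fin_one, map_sub,
          aeval_C, aeval_X, eq_ratCast, Rat.cast_one]
  · intro z hz
    have hA := hasFDerivAt_apply (𝕜 := ℝ) 0 z
    have hB := hasFDerivAt_apply (𝕜 := ℝ) 1 z
    have hB' := hB.const_sub (1:ℝ)
    have hpi : HasFDerivAt Φ (Φ' z) z := by
      rw [hasFDerivAt_pi']
      intro i
      fin_cases i
      · refine (hA.congr_fderiv ?_).congr_of_eventuallyEq (Filter.Eventually.of_forall fun y => ?_)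
        · ext w
          simp [hΦ'ap]
        · simp only [Fin.zero_eta, hΦ0]
      · refine (hB'.congr_fderiv ?_).congr_of_eventuallyEq (Filter.Eventually.of_forall fun y => ?_)
        · ext w
          simp [hΦ'ap]
        · simp only [Fin.mk_one, hΦ1]
    exact hpi.hasFDerivWithinAt
  · intro z₁ hz₁ z₂ hz₂ heq
    have e0 : z₁ 0 = z₂ 0 := by
      have := congrFun heq 0
      simpa [Φ] using this
    have e1 : 1 - z₁ 1 = 1 - z₂ 1 := by
      have := congrFun heq 1
      simpa [Φ] using this
    funext i
    fin_cases i
    · exact e0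
    · show z₁ 1 = z₂ 1; linarith
  · intro z hz
    rw [hdet z, abs_neg, abs_one, mul_one]
    simp only [AngHMneg, AngHFan, KZ.IntegralRep.integrand_restrict, RFun.rep_integrand]
    simp only [AngH, AngDen, RFun.fn, Φ, map_add, map_sub, map_mul, aeval_C, aeval_X, eq_ratCast, Rat.cast_one,
      Rat.cast_ofNat, vec2_0, vec2_1, Matrix.cons_val_zero, Matrix.cons_val_one, Matrix.head_cons]
    ring

/-- Auxiliary definition `sQa`: s Qa. [bookkeeping] -/
def sQa : Set (Fin 2 → ℝ) := {z | 7 * ((4 * z 1 - 2) * (4 * z 1 - 2)) ≤ 1}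
/-- Auxiliary definition `sQac`: s Qac. [bookkeeping] -/
def sQac : Set (Fin 2 → ℝ) := {z | 1 ≤ 7 * ((4 * z 1 - 2) * (4 * z 1 - 2))}
/-- Auxiliary step `isSemialgebraic_sQa`: is Semialgebraic s Qa. [bookkeeping] -/
theorem isSemialgebraic_sQa : IsSemialgebraic ℚ sQa :=
  isSemialgebraic_of_le (C 7 * ((C 4 * X 1 - C 2) * (C 4 * X 1 - C 2))) (C 1) sQa fun z => by
    simp only [sQa, mem_setOf_eq, map_mul, map_sub, aeval_C, aeval_X, eq_ratCast, Rat.cast_ofNat, Rat.cast_one]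
/-- Auxiliary step `isSemialgebraic_sQac`: is Semialgebraic s Qac. [bookkeeping] -/
theorem isSemialgebraic_sQac : IsSemialgebraic ℚ sQac :=
  isSemialgebraic_of_le (C 1) (C 7 * ((C 4 * X 1 - C 2) * (C 4 * X 1 - C 2))) sQac fun z => by
    simp only [sQac, mem_setOf_eq, map_mul, map_sub, aeval_C, aeval_X, eq_ratCast, Rat.cast_ofNat, Rat.cast_one]
/-- `R₀ = Fan ∩ {7Q² ≤ 1}` (the lattice rectangle `[α₁, θ−α₁] × [0, α₁]`; `Q ≤ P` is redundant on it) and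
`T₂ = Fan ∩ {7Q² ≥ 1}` (the lattice triangle `α₁ ≤ ψ ≤ φ ≤ θ−α₁`). -/
def FanLo : Set (Fin 2 → ℝ) := Fan ∩ sQa
/-- Auxiliary definition `FanHi`: Fan Hi. [bookkeeping] -/
def FanHi : Set (Fin 2 → ℝ) := Fan ∩ sQac
/-- Auxiliary definition `AngHFanLo`: Ang HFan Lo. [bookkeeping] -/
def AngHFanLo : KZ.IntegralRep 2 :=
  AngH.rep.restrict FanLo (isSemialgebraic_Fan.inter isSemialgebraic_sQa) (fun _ hz => hz.1.1)
/-- Auxiliary definition `AngHFanHi`: Ang HFan Hi. [bookkeeping] -/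
def AngHFanHi : KZ.IntegralRep 2 :=
  AngH.rep.restrict FanHi (isSemialgebraic_Fan.inter isSemialgebraic_sQac) (fun _ hz => hz.1.1)

/-- Auxiliary step `volume_sQa_line`: volume s Qa line. [bookkeeping] -/
theorem volume_sQa_line : MeasureTheory.volume {z : Fin 2 → ℝ | 7 * ((4 * z 1 - 2) * (4 * z 1 - 2)) = 1} = 0 := by
  have h := volume_setOf_aeval_eq_zero (k := ℚ) (m := 2)
    (C 7 * ((C 4 * X 1 - C 2) * (C 4 * X 1 - C 2)) - C 1 : MvPolynomial (Fin 2) ℚ) (by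
    intro h0
    have h1 := congr_arg (MvPolynomial.eval (fun _ => (0:ℝ))) h0
    simp at h1
    norm_num at h1)
  have e : {x : Fin 2 → ℝ | aeval x (C 7 * ((C 4 * X 1 - C 2) * (C 4 * X 1 - C 2)) - C 1 :
      MvPolynomial (Fin 2) ℚ) = 0} = {z : Fin 2 → ℝ | 7 * ((4 * z 1 - 2) * (4 * z 1 - 2)) = 1} := by
    ext z
    simp only [mem_setOf_eq, map_sub, map_mul, aeval_C, aeval_X, eq_ratCast, Rat.cast_ofNat, Rat.cast_one,
      sub_eq_zero]
  rw [← e]; exact h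

/-- the null-line cut `[AngH | Fan] ≡ [AngH | R₀] + [AngH | T₂]` at `ψ = α₁`. -/
theorem AngHFan_cut : KZ.of AngHFan - KZ.of AngHFanLo - KZ.of AngHFanHi ∈ KZ.relations :=
  rel_cut AngHFan AngHFanLo AngHFanHi (fun z => 7 * ((4 * z 1 - 2) * (4 * z 1 - 2))) 1 rfl rfl volume_sQa_line
    (fun _ _ => rfl) (fun _ _ => rfl)

/-- the lattice square `B = [α₁, θ−α₁]² = {1 ≤ 7P² ≤ 9, 0 ≤ Q, 1 ≤ 7Q² ≤ 9}`. -/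
def Bsq : Set (Fin 2 → ℝ) := cube 2 ∩ (sRM1 ∩ sRM2 ∩ sU1 ∩ sQac ∩ sI3)
/-- Auxiliary step `isSemialgebraic_Bsq`: is Semialgebraic Bsq. [bookkeeping] -/
theorem isSemialgebraic_Bsq : IsSemialgebraic ℚ Bsq := by
  refine KZ.isSemialgebraic_cube.inter (((((?_ : IsSemialgebraic ℚ sRM1).inter ?_).inter ?_).inter
    isSemialgebraic_sQac).inter ?_)
  · exact isSemialgebraic_of_le (C 1) (C 28 * X 0 * X 0) sRM1 fun z => by
      simp only [sRM1, mem_setOf_eq, map_mul, aeval_C, aeval_X, eq_ratCast, Rat.cast_ofNat, Rat.cast_one]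
  · exact isSemialgebraic_of_le (C 28 * X 0 * X 0) (C 9) sRM2 fun z => by
      simp only [sRM2, mem_setOf_eq, map_mul, aeval_C, aeval_X, eq_ratCast, Rat.cast_ofNat]
  · exact isSemialgebraic_of_le (C 2) (C 4 * X 1) sU1 fun z => by
      simp only [sU1, mem_setOf_eq, map_mul, aeval_C, aeval_X, eq_ratCast, Rat.cast_ofNat]
  · exact isSemialgebraic_of_le (C 7 * ((C 4 * X 1 - C 2) * (C 4 * X 1 - C 2))) (C 9) sI3 fun z => by
      simp only [sI3, mem_setOf_eq, map_mul, map_sub, aeval_C, aeval_X, eq_ratCast, Rat.cast_ofNat]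
/-- Auxiliary definition `BsqD`: Bsq D. [bookkeeping] -/
def BsqD : Set (Fin 2 → ℝ) := Bsq ∩ sDl
/-- Auxiliary definition `BsqU`: Bsq U. [bookkeeping] -/
def BsqU : Set (Fin 2 → ℝ) := Bsq ∩ sDu
/-- Auxiliary definition `AngHBsq`: Ang HBsq. [bookkeeping] -/
def AngHBsq : KZ.IntegralRep 2 := AngH.rep.restrict Bsq isSemialgebraic_Bsq (fun _ hz => hz.1)
/-- Auxiliary definition `AngHBsqD`: Ang HBsq D. [bookkeeping] -/
def AngHBsqD : KZ.IntegralRep 2 :=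
  AngH.rep.restrict BsqD (isSemialgebraic_Bsq.inter isSemialgebraic_sDl) (fun _ hz => hz.1.1)
/-- Auxiliary definition `AngHBsqU`: Ang HBsq U. [bookkeeping] -/
def AngHBsqU : KZ.IntegralRep 2 :=
  AngH.rep.restrict BsqU (isSemialgebraic_Bsq.inter isSemialgebraic_sDu) (fun _ hz => hz.1.1)

/-- the diagonal cut `[AngH | B] ≡ [AngH | B ∩ {Q ≤ P}] + [AngH | B ∩ {Q ≥ P}]`. -/
theorem AngHBsq_cut : KZ.of AngHBsq - KZ.of AngHBsqD - KZ.of AngHBsqU ∈ KZ.relations := by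
  have hnull : MeasureTheory.volume {z : Fin 2 → ℝ | 4 * z 1 - 2 - 2 * z 0 = 0} = 0 := by
    have h := volume_setOf_aeval_eq_zero (k := ℚ) (m := 2) (C 4 * X 1 - C 2 - C 2 * X 0 : MvPolynomial (Fin 2) ℚ)
      (by
        intro h0
        have h1 := congr_arg (MvPolynomial.eval (fun _ => (0:ℝ))) h0
        simp at h1)
    have e : {x : Fin 2 → ℝ | aeval x (C 4 * X 1 - C 2 - C 2 * X 0 : MvPolynomial (Fin 2) ℚ) = 0} =
        {z : Fin 2 → ℝ | 4 * z 1 - 2 - 2 * z 0 = 0} := by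
      ext z
      simp only [mem_setOf_eq, map_sub, map_mul, aeval_C, aeval_X, eq_ratCast, Rat.cast_ofNat]
    rw [← e]; exact h
  exact rel_cut AngHBsq AngHBsqD AngHBsqU (fun z => 4 * z 1 - 2 - 2 * z 0) 0 rfl rfl hnull
    (fun _ _ => rfl) (fun _ _ => rfl)

/-- `B ∩ {Q ≤ P} = T₂`. -/
theorem BsqD_eq_FanHi : BsqD = FanHi := by
  ext z
  constructor
  · rintro ⟨⟨hc, ⟨⟨⟨⟨r1, r2⟩, u1⟩, qa⟩, i3⟩⟩, dl⟩
    simp only [sDl, mem_setOf_eq] at dl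
    refine ⟨⟨hc, ⟨⟨⟨r1, r2⟩, u1⟩, ?_⟩⟩, qa⟩
    simp only [sU2, mem_setOf_eq]; linarith
  · rintro ⟨⟨hc, ⟨⟨⟨r1, r2⟩, u1⟩, u2⟩⟩, qa⟩
    have h0 := (cube2 hc).1
    simp only [sRM1, sRM2, sU1, sU2, sQac, mem_setOf_eq] at r1 r2 u1 u2 qa
    have hQ0 : (0:ℝ) ≤ 4 * z 1 - 2 := by linarith
    refine ⟨⟨hc, ⟨⟨⟨⟨r1, r2⟩, u1⟩, qa⟩, ?_⟩⟩, ?_⟩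
    · simp only [sI3, mem_setOf_eq]
      nlinarith [mul_le_mul u2 u2 hQ0 (by linarith), mul_self_nonneg (z 0)]
    · simp only [sDl, mem_setOf_eq]; linarith

/-- `B ∩ {Q ≥ P} = S'_hi`. -/
theorem BsqU_eq_SHi : BsqU = SHi := by
  ext z
  constructor
  · rintro ⟨⟨hc, ⟨⟨⟨⟨r1, r2⟩, u1⟩, qa⟩, i3⟩⟩, du⟩
    simp only [sDu, mem_setOf_eq] at du
    refine ⟨hc, ⟨⟨⟨r1, r2⟩, ?_⟩, i3⟩⟩
    simp only [sU2m, mem_setOf_eq]; linarith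
  · rintro ⟨hc, ⟨⟨⟨r1, r2⟩, u2⟩, i3⟩⟩
    have h0 := (cube2 hc).1
    simp only [sRM1, sRM2, sU2m, sI3, mem_setOf_eq] at r1 r2 u2 i3
    have hp : (0:ℝ) ≤ 2 * z 0 := by linarith [h0.1]
    refine ⟨⟨hc, ⟨⟨⟨⟨r1, r2⟩, ?_⟩, ?_⟩, i3⟩⟩, ?_⟩
    · simp only [sU1, mem_setOf_eq]; linarith
    · simp only [sQac, mem_setOf_eq]
      nlinarith [mul_le_mul u2 u2 hp (by linarith), mul_self_nonneg (z 0)]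
    · simp only [sDu, mem_setOf_eq]; linarith

/-- Auxiliary step `AngHBsqD_FanHi`: Ang HBsq D Fan Hi. [bookkeeping] -/
theorem AngHBsqD_FanHi : KZ.of AngHBsqD - KZ.of AngHFanHi ∈ KZ.relations :=
  KZ.of_sub_of_mem_relations_of_eqOn
    (by simp only [AngHBsqD, AngHFanHi, KZ.IntegralRep.domain_restrict, BsqD_eq_FanHi]) (fun _ _ => rfl)
/-- Auxiliary step `AngHBsqU_SHi`: Ang HBsq U SHi. [bookkeeping] -/
theorem AngHBsqU_SHi : KZ.of AngHBsqU - KZ.of AngHSHi ∈ KZ.relations :=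
  KZ.of_sub_of_mem_relations_of_eqOn
    (by simp only [AngHBsqU, AngHSHi, KZ.IntegralRep.domain_restrict, BsqU_eq_SHi]) (fun _ _ => rfl)

/-- **hAng4 reduced to seven LATTICE line polygons (file of record, end of g9).**  Modulo KZ-relations,
`[AngH|RM] + [AngH|RK₊] + [AngH|RK₋] ≡ [AngH|R₀] + [AngH|B] + [AngH|RM_rect] + [AngH|Trap'_lo] + [AngH|Trap'_hi]
 + [AngH|Ũ₋'] + [AngH|S'_lo]`: in angles, `R₀ = [α₁,θ−α₁]×[0,α₁]`, `B = [α₁,θ−α₁]²`, `RM_rect = [α₁,θ−α₁]×[0,2α₁]`,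
`Trap'_lo = {0≤ψ≤φ≤α₁}`, `Trap'_hi = {0≤φ≤α₁, φ≤ψ≤φ+α₁}`, `Ũ₋' = {φ,ψ≥0, φ+ψ≤α₁}`,
`S'_lo = {α₁≤φ≤θ−α₁, φ−α₁≤ψ≤φ}` — areas `α₁β + β² + 2α₁β + α₁²/2 + α₁² + α₁²/2 + α₁β = θ² − 2α₁²` (`β = θ−2α₁`). -/
theorem hAng4_lattice :
    KZ.of AngHM + KZ.of AngHp + KZ.of AngHm
      - KZ.of AngHFanLo - KZ.of AngHBsq - KZ.of AngHMrect - KZ.of AngHTrapLo - KZ.of AngHTrapHi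
      - KZ.of AngHUmr - KZ.of AngHSLo ∈ KZ.relations := by
  have h := sub_mem (sub_mem (sub_mem (add_mem (add_mem hAng4_polygons AngHMneg_reflect) AngHFan_cut)
    AngHBsq_cut) AngHBsqD_FanHi) AngHBsqU_SHi
  convert h using 1
  abel

/-- **hAng4 ⟸ rational lattice-polygon algebra.**  `hAng4` of `pair18_g8strips_of_grid` (file #1, v14) follows
from `[R₀] + [B] + [RM_rect] + [Trap'_lo] + [Trap'_hi] + [Ũ₋'] + [S'_lo] ≡ [Th7] − 2·[B17]`; recipe (NODE §9.23):
shear `Trap'_hi ↦ [0,α₁]²`, `Ũ₋' ↦ swap Trap'_lo` (then `Trap'_lo + swap Trap'_lo = [0,α₁]²` by the diagonal cut),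
`S'_lo ↦` (shear, reflect) `R₀`, cut `RM_rect = R₀ ⊔ [α₁,θ−α₁]×[α₁,2α₁]` — all rational in this chart — then the
9-rectangle dissection of `Th7 ≡ A([0,θ]²)` in the `B17` chart and four algebraic `1/√7`-scalings. -/
theorem hAng4_of_lattice
    (hLat : KZ.of AngHFanLo + KZ.of AngHBsq + KZ.of AngHMrect + KZ.of AngHTrapLo + KZ.of AngHTrapHi
      + KZ.of AngHUmr + KZ.of AngHSLo - KZ.of Th7.rep + 2 • KZ.of B17.rep ∈ KZ.relations) :
    KZ.of AngHM + KZ.of AngHp + KZ.of AngHm - KZ.of Th7.rep + 2 • KZ.of B17.rep ∈ KZ.relations := by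
  have h := add_mem hAng4_lattice hLat
  convert h using 1
  abel

/-! ### §19m  hAng4 bookkeeping: `RM_rect = R₀ ⊔ R₁` at `ψ = α₁` (`7Q² = 1`), `R₁ = [α₁, θ−α₁] × [α₁, 2α₁]`

After this cut the cell list is `2·[R₀] + [R₁] + [B] + [Trap'_lo] + [Trap'_hi] + [Ũ₋'] + [S'_lo]`, to be compared with
`[Th7] − 2[B17] ≡ 2[Sqα] + 3[R₀] + [R₁] + [B]` (NODE §9.23): what remains RATIONAL in this chart is
`[Trap'_hi] ≡ [Sqα]`, `[Trap'_lo] + [Ũ₋'] ≡ [Sqα]`, `[S'_lo] ≡ [R₀]` (three shears), then the chart transfer. -/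

/-- Auxiliary definition `RMrectLo` (§19m): RMrect Lo. [bookkeeping] -/
def RMrectLo : Set (Fin 2 → ℝ) := RMrect ∩ sQa
/-- `R₁ = RM_rect ∩ {7Q² ≥ 1} = {1 ≤ 7P² ≤ 9, 1 ≤ 7Q², 9Q² ≤ 7}` (+ the redundant `sRM3`, `sRM4`). -/
def RMrectHi : Set (Fin 2 → ℝ) := RMrect ∩ sQac
/-- Auxiliary definition `AngHMrectLo` (§19m): Ang HMrect Lo. [bookkeeping] -/
def AngHMrectLo : KZ.IntegralRep 2 :=
  AngH.rep.restrict RMrectLo (isSemialgebraic_RMrect.inter isSemialgebraic_sQa) (fun _ hz => hz.1.1.1.1)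
/-- Auxiliary definition `AngHMrectHi` (§19m): Ang HMrect Hi. [bookkeeping] -/
def AngHMrectHi : KZ.IntegralRep 2 :=
  AngH.rep.restrict RMrectHi (isSemialgebraic_RMrect.inter isSemialgebraic_sQac) (fun _ hz => hz.1.1.1.1)

/-- the null-line cut `[AngH | RM_rect] ≡ [AngH | RM_rect ∩ {7Q² ≤ 1}] + [AngH | R₁]`. -/
theorem AngHMrect_cut : KZ.of AngHMrect - KZ.of AngHMrectLo - KZ.of AngHMrectHi ∈ KZ.relations :=
  rel_cut AngHMrect AngHMrectLo AngHMrectHi (fun z => 7 * ((4 * z 1 - 2) * (4 * z 1 - 2))) 1 rfl rfl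
    volume_sQa_line (fun _ _ => rfl) (fun _ _ => rfl)

/-- `RM_rect ∩ {7Q² ≤ 1} = R₀` (`= Fan ∩ {7Q² ≤ 1}`): on both sides only `1 ≤ 7P² ≤ 9, 0 ≤ Q, 7Q² ≤ 1` bite. -/
theorem RMrectLo_eq_FanLo : RMrectLo = FanLo := by
  ext z
  constructor
  · rintro ⟨⟨⟨⟨hc, ⟨⟨⟨r1, r2⟩, r3⟩, r4⟩⟩, u1⟩, hl⟩, qa⟩
    have h0 := (cube2 hc).1
    simp only [sRM1, sRM2, sU1, sQa, mem_setOf_eq] at r1 r2 u1 qa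
    have hp : (0:ℝ) ≤ 2 * z 0 := by linarith [h0.1]
    have hQ0 : (0:ℝ) ≤ 4 * z 1 - 2 := by linarith
    have h2 : (4 * z 1 - 2) ^ 2 ≤ (2 * z 0) ^ 2 := by nlinarith
    have hQP := (pow_le_pow_iff_left₀ hQ0 hp two_ne_zero).mp h2
    refine ⟨⟨hc, ⟨⟨⟨r1, r2⟩, ?_⟩, ?_⟩⟩, ?_⟩
    · simp only [sU1, mem_setOf_eq]; linarith
    · simp only [sU2, mem_setOf_eq]; exact hQP
    · simp only [sQa, mem_setOf_eq]; exact qa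
  · rintro ⟨⟨hc, ⟨⟨⟨r1, r2⟩, u1⟩, u2⟩⟩, qa⟩
    have h0 := (cube2 hc).1
    simp only [sRM1, sRM2, sU1, sU2, sQa, mem_setOf_eq] at r1 r2 u1 u2 qa
    have hQ0 : (0:ℝ) ≤ 4 * z 1 - 2 := by linarith
    refine ⟨⟨⟨⟨hc, ⟨⟨⟨r1, r2⟩, ?_⟩, ?_⟩⟩, ?_⟩, ?_⟩, ?_⟩
    · simp only [sRM3, mem_setOf_eq]; linarith [h0.1]
    · simp only [sRM4, mem_setOf_eq]; nlinarith [mul_self_nonneg (z 0)]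
    · simp only [sU1, mem_setOf_eq]; linarith
    · simp only [sL, mem_setOf_eq]; nlinarith
    · simp only [sQa, mem_setOf_eq]; exact qa

/-- Auxiliary step `AngHMrectLo_FanLo` (§19m): Ang HMrect Lo Fan Lo. [bookkeeping] -/
theorem AngHMrectLo_FanLo : KZ.of AngHMrectLo - KZ.of AngHFanLo ∈ KZ.relations :=
  KZ.of_sub_of_mem_relations_of_eqOn
    (by simp only [AngHMrectLo, AngHFanLo, KZ.IntegralRep.domain_restrict, RMrectLo_eq_FanLo]) (fun _ _ => rfl)

end Fold
end Summit.KontsevichZagierPeriods.RootDecompQuadraticDescent.Pair18Homotopy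
end
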